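import Summits.Ventures.CertifiedQuantumChemistry.Rows.HubbardRingTVHoppingSign
import Summits.Ventures.CertifiedQuantumChemistry.Barriers.DifferencePencilCeiling
import Literature.MathematicalPhysics.QuantumLattice.HubbardTTPrimeScaleHomogeneity
import HarnessLib

/-!
# Ventures/CertifiedQuantumChemistry — Rows/HubbardRingTVScaleHomogeneity.lean: POSITIVE HOMOGENEITY —
# `E₀`, `OPT_DQG` and `OPT_DQG+S²` of `hubbardRingTV L (ct) (cU)` are `c` times those of
# `hubbardRingTV L t U`; the scaled gap `ĉ_X` of conjecture S-U depends on `(t, U)` through `t/U` only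

HONEST FRAMING (verbatim): certified bounds for a stated model Hamiltonian in a stated basis; not a
claim about the real molecule beyond that model.

Seat rdm-B, ROWS courtesy file (theorems only; no `def`, no notation, no instance; zero compute). It
types the second 'exact, no data' half of the structure sentence of
`run/shared/lean/pub/pub-qchem/STRUCTURE.md` §2.2.7 / §2.2.8 (i)(a): «with the programme's
homogeneity `OPT_X(t, U) = U·f_X(t/U)`» (the first half, evenness of `f_X`, is
`Rows/HubbardRingTVHoppingSign.lean`). The energy functional `E_{h,g,h_nuc}(γ, Γ)` is LINEAR in the
integral tables and the feasible sets of the two-positivity programmes do not depend on the tables, so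
scaling all tables by `c ≥ 0` scales every optimal value by `c`; the second-quantised map is linear
too, so the exact sector energy scales the same way; and the TV-H tables of `hubbardRingTV L (ct) (cU)`
ARE `c` times those of `hubbardRingTV L t U`:

* §1 (abstract `Λ`; the linearity `E_{c•h, c•g, c·h_nuc} = c·E_{h,g,h_nuc}` is the tree's `rdmEnergy_smul_tables`):
  **`pqgSectorEnergy_tables_smul`**, **`pqgSingletEnergy_tables_smul`** (`c ≥ 0` real:
  `E_PQG(c•T) = c·E_PQG(T)` at both registered levels; `sInf (c • S) = c · sInf S`),
  **`sectorGroundEnergy_tables_smul`** (`E₀(Ĥ(c•T)) = c·E₀(Ĥ(T))`, via the tree's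
  `Model.molecularHamiltonian_smul` and `Matrix.minEnergyOn_real_smul`);
* §2 (the ring) `ScaleHom.h_scale` / `eri_scale` / `ecore_scale` — the tables of
  `hubbardRingTV L (c*t) (c*U)` are `c •` those of `hubbardRingTV L t U` (as complex tables);
* §3 **`hubbardRingTV_energy_scale`**, **`hubbardRingTV_pqgSectorEnergy_scale`**,
  **`hubbardRingTV_pqgSingletEnergy_scale`**: for `0 ≤ c` and all `t U : ℚ`,
  `X(hubbardRingTV L (c*t) (c*U)) = c · X(hubbardRingTV L t U)` for `X ∈ {E₀(·; a, b),
  OPT_DQG(·; a, b), OPT_DQG+S²(·; n)}`; the UNIT FORMS `X(L; t, U) = U · X(L; t/U, 1)` (`U > 0`: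
  `…_eq_mul_unit`);
* §4 **`hubbardRingTV_scaledGap_sector_eq_unit`**, **`hubbardRingTV_scaledGap_singlet_eq_unit`**:
  for `U > 0`, `t ≠ 0` the scaled gap `ĉ_X(L; t, U) = (U/4t²)·(E₀ − OPT_X)(L; t, U)` EQUALS
  `(1/4x²)·(E₀ − OPT_X)(L; x, 1)` at `x = t/U`: it is a function of `t/U` ALONE (the `f_X` of §2.2.7);
  in the conjecture leaf's spelling (`t = 1`) the S-U gap at repulsion `U` is the gap of the
  UNIT-REPULSION ring at hopping `1/U` (`hubbardRingTV_conjectureGap_{sector,singlet}_eq_unit`) — and,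
  with `Rows/HubbardRingTVHoppingSign.lean`, at hopping `−1/U` as well (`…_eq_unit_neg`, `L` even):
  the strong-coupling limit `U → ∞` of S-U is the two-sided small-hopping limit `x → 0` of ONE
  unit-repulsion ring, in which `f_X` is even.

READING: statements about the ABSTRACT programme values and the exact energy of the cell's own model
object `hubbardRingTV`; no certificate, row, hint, claim node or value of record depends on them; the
conjecture leaves are imported (through `Rows/HubbardRingTVHoppingSign.lean`) for the SPELLING
`Model.pqgSectorEnergy` / `Model.pqgSingletEnergy` only and are untouched; nothing here is a
convergence or analyticity statement. Everything is PROVED (0 sorry, standard axioms).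

References: T. Koma, H. Tasaki, J. Stat. Phys. 76 (1994) 745, §1 (scale-free sector ground states;
the tree's `Matrix.minEnergyOn_real_smul`); D. A. Mazziotti, Adv. Chem. Phys. 134 (2007) ch. 3 §II.A
eqs. (4)–(7) (the functional is linear in the reduced Hamiltonian). Tree (REUSED): `rdmEnergy_smul_tables` (`Barriers/DifferencePencilCeiling`);
`Model.molecularHamiltonian_smul` (`Rows/DifferencePencilRows`);
`Matrix.minEnergyOn_real_smul` (`QuantumLattice/HubbardTTPrimeScaleHomogeneity`); `sectorGroundEnergy_def`,
`pqgSectorEnergy`, `pqgSingletEnergy`, `IsDQGFeasibleSector`, `IsDQGFeasibleSinglet` (Literature);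
`hubbardRingTV_energy_neg_hopping`, `hubbardRingTV_pqg{Sector,Singlet}Energy_neg_hopping`
(`Rows/HubbardRingTVHoppingSign`). Mathlib: `Real.sInf_smul_of_nonneg`.
-/

noncomputable section

namespace Summit.Ventures.CertifiedQuantumChemistry

open Matrix Finset
open Literature.MathematicalPhysics.QuantumLattice Literature.MathematicalPhysics.QuantumChemistry
open Summit.Ventures.CertifiedQuantumChemistry.Hamiltonians
open scoped ComplexOrder Pointwise

/-! ## §1 Scaling the integral tables scales the functional, the values and the exact energy -/

section Abstract

variable {Λ : Type*} [LinearOrder Λ] [Fintype Λ]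

/-- **Positive homogeneity of the `S_z`-sector DQG value**: `E_PQG(c•h, c•g, c·h_nuc; N_α, N_β)
= c · E_PQG(h, g, h_nuc; N_α, N_β)` for real `c ≥ 0` (the feasible set does not see the tables, the
functional is linear in them, `sInf (c • S) = c · sInf S`). -/
theorem pqgSectorEnergy_tables_smul {c : ℝ} (hc : 0 ≤ c) (h : Λ → Λ → ℂ) (g : Λ → Λ → Λ → Λ → ℂ)
    (hnuc : ℂ) (a b : ℕ) :
    pqgSectorEnergy ((c : ℂ) • h) ((c : ℂ) • g) ((c : ℂ) * hnuc) a b = c * pqgSectorEnergy h g hnuc a b := by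
  unfold pqgSectorEnergy
  have hset : {E : ℝ | ∃ γ Γ, IsDQGFeasibleSector a b γ Γ ∧
        E = (rdmEnergy ((c : ℂ) • h) ((c : ℂ) • g) ((c : ℂ) * hnuc) γ Γ).re} =
      c • {E : ℝ | ∃ γ Γ, IsDQGFeasibleSector a b γ Γ ∧ E = (rdmEnergy h g hnuc γ Γ).re} := by
    ext E
    simp only [Set.mem_setOf_eq, Set.mem_smul_set, smul_eq_mul]
    constructor
    · rintro ⟨γ, Γ, hf, rfl⟩
      exact ⟨_, ⟨γ, Γ, hf, rfl⟩, by rw [rdmEnergy_smul_tables, Complex.re_ofReal_mul]⟩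
    · rintro ⟨E', ⟨γ, Γ, hf, rfl⟩, rfl⟩
      exact ⟨γ, Γ, hf, by rw [rdmEnergy_smul_tables, Complex.re_ofReal_mul]⟩
  rw [hset, Real.sInf_smul_of_nonneg hc, smul_eq_mul]

/-- **Positive homogeneity of the singlet-restricted (`⟨Ŝ²⟩ = 0`) DQG value**:
`E_PQG(c•T; 2n, S = 0) = c · E_PQG(T; 2n, S = 0)` for real `c ≥ 0`. -/
theorem pqgSingletEnergy_tables_smul {c : ℝ} (hc : 0 ≤ c) (h : Λ → Λ → ℂ) (g : Λ → Λ → Λ → Λ → ℂ)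
    (hnuc : ℂ) (n : ℕ) :
    pqgSingletEnergy ((c : ℂ) • h) ((c : ℂ) • g) ((c : ℂ) * hnuc) n = c * pqgSingletEnergy h g hnuc n := by
  unfold pqgSingletEnergy
  have hset : {E : ℝ | ∃ γ Γ, IsDQGFeasibleSinglet n γ Γ ∧
        E = (rdmEnergy ((c : ℂ) • h) ((c : ℂ) • g) ((c : ℂ) * hnuc) γ Γ).re} =
      c • {E : ℝ | ∃ γ Γ, IsDQGFeasibleSinglet n γ Γ ∧ E = (rdmEnergy h g hnuc γ Γ).re} := by
    ext E
    simp only [Set.mem_setOf_eq, Set.mem_smul_set, smul_eq_mul]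
    constructor
    · rintro ⟨γ, Γ, hf, rfl⟩
      exact ⟨_, ⟨γ, Γ, hf, rfl⟩, by rw [rdmEnergy_smul_tables, Complex.re_ofReal_mul]⟩
    · rintro ⟨E', ⟨γ, Γ, hf, rfl⟩, rfl⟩
      exact ⟨γ, Γ, hf, by rw [rdmEnergy_smul_tables, Complex.re_ofReal_mul]⟩
  rw [hset, Real.sInf_smul_of_nonneg hc, smul_eq_mul]

/-- **Positive homogeneity of the exact sector energy**: `E₀(Ĥ(c•T); N_α, N_β) = c · E₀(Ĥ(T); N_α, N_β)`
for real `c ≥ 0` (`Ĥ(c•T) = c•Ĥ(T)` and sector ground energies are scale-free). -/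
theorem sectorGroundEnergy_tables_smul {c : ℝ} (hc : 0 ≤ c) (h : Λ → Λ → ℂ) (g : Λ → Λ → Λ → Λ → ℂ)
    (hnuc : ℂ) (a b : ℕ) :
    sectorGroundEnergy (molecularHamiltonian ((c : ℂ) • h) ((c : ℂ) • g) ((c : ℂ) * hnuc)) a b =
      c * sectorGroundEnergy (molecularHamiltonian h g hnuc) a b := by
  rw [Model.molecularHamiltonian_smul, sectorGroundEnergy_def, sectorGroundEnergy_def,
    Matrix.minEnergyOn_real_smul _ _ hc]

end Abstract

/-! ## §2 The TV-H tables scale with `(t, U)` -/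

namespace ScaleHom

/-- The one-electron table of `hubbardRingTV L (c*t) (c*U)` is `c` times that of `hubbardRingTV L t U`. -/
theorem h_scale (L : ℕ) (c t U : ℚ) :
    (fun p q => (((hubbardRingTV L (c * t) (c * U)).h p q : ℚ) : ℂ)) =
      ((c : ℝ) : ℂ) • fun p q => (((hubbardRingTV L t U).h p q : ℚ) : ℂ) := by
  funext p q
  simp only [hubbardRingTV, Pi.smul_apply, smul_eq_mul, Complex.ofReal_ratCast]
  split_ifs <;> push_cast <;> ring

/-- The two-electron table of `hubbardRingTV L (c*t) (c*U)` is `c` times that of `hubbardRingTV L t U`. -/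
theorem eri_scale (L : ℕ) (c t U : ℚ) :
    (fun p q r s => (((hubbardRingTV L (c * t) (c * U)).eri p q r s : ℚ) : ℂ)) =
      ((c : ℝ) : ℂ) • fun p q r s => (((hubbardRingTV L t U).eri p q r s : ℚ) : ℂ) := by
  funext p q r s
  simp only [hubbardRingTV, Pi.smul_apply, smul_eq_mul, Complex.ofReal_ratCast]
  split_ifs <;> push_cast <;> ring

/-- The scalar: `0 = c · 0`. -/
theorem ecore_scale (L : ℕ) (c t U : ℚ) :
    (((hubbardRingTV L (c * t) (c * U)).ecore : ℚ) : ℂ) =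
      ((c : ℝ) : ℂ) * (((hubbardRingTV L t U).ecore : ℚ) : ℂ) := by
  simp [hubbardRingTV]

end ScaleHom

open ScaleHom

/-! ## §3 Positive homogeneity of `E₀`, `OPT_DQG`, `OPT_DQG+S²` on the ring; unit forms -/

/-- **`E₀(L; ct, cU; a, b) = c · E₀(L; t, U; a, b)`** for `c ≥ 0` (every sector, every `t, U ∈ ℚ`). -/
theorem hubbardRingTV_energy_scale (L : ℕ) {c : ℚ} (hc : 0 ≤ c) (t U : ℚ) (a b : ℕ) :
    Model.energy (hubbardRingTV L (c * t) (c * U)) a b = (c : ℝ) * Model.energy (hubbardRingTV L t U) a b := by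
  unfold Model.energy Model.hamiltonian
  rw [h_scale, eri_scale, ecore_scale]
  exact sectorGroundEnergy_tables_smul (by exact_mod_cast hc) _ _ _ a b

/-- **`OPT_DQG(L; ct, cU; a, b) = c · OPT_DQG(L; t, U; a, b)`** for `c ≥ 0`. -/
theorem hubbardRingTV_pqgSectorEnergy_scale (L : ℕ) {c : ℚ} (hc : 0 ≤ c) (t U : ℚ) (a b : ℕ) :
    Model.pqgSectorEnergy (hubbardRingTV L (c * t) (c * U)) a b =
      (c : ℝ) * Model.pqgSectorEnergy (hubbardRingTV L t U) a b := by
  unfold Model.pqgSectorEnergy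
  rw [h_scale, eri_scale, ecore_scale]
  exact pqgSectorEnergy_tables_smul (by exact_mod_cast hc) _ _ _ a b

/-- **`OPT_DQG+S²(L; ct, cU; n) = c · OPT_DQG+S²(L; t, U; n)`** for `c ≥ 0`. -/
theorem hubbardRingTV_pqgSingletEnergy_scale (L : ℕ) {c : ℚ} (hc : 0 ≤ c) (t U : ℚ) (n : ℕ) :
    Model.pqgSingletEnergy (hubbardRingTV L (c * t) (c * U)) n =
      (c : ℝ) * Model.pqgSingletEnergy (hubbardRingTV L t U) n := by
  unfold Model.pqgSingletEnergy
  rw [h_scale, eri_scale, ecore_scale]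
  exact pqgSingletEnergy_tables_smul (by exact_mod_cast hc) _ _ _ n

/-- Bookkeeping: for `U ≠ 0`, `hubbardRingTV L t U = hubbardRingTV L (U * (t / U)) (U * 1)`. -/
theorem hubbardRingTV_eq_unit_scaled (L : ℕ) (t : ℚ) {U : ℚ} (hU : U ≠ 0) :
    hubbardRingTV L t U = hubbardRingTV L (U * (t / U)) (U * 1) := by
  rw [mul_div_cancel₀ t hU, mul_one]

/-- **UNIT FORM of the exact energy**: `E₀(L; t, U; a, b) = U · E₀(L; t/U, 1; a, b)` for `U > 0`. -/
theorem hubbardRingTV_energy_eq_mul_unit (L : ℕ) (t : ℚ) {U : ℚ} (hU : 0 < U) (a b : ℕ) :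
    Model.energy (hubbardRingTV L t U) a b = (U : ℝ) * Model.energy (hubbardRingTV L (t / U) 1) a b := by
  rw [hubbardRingTV_eq_unit_scaled L t hU.ne', hubbardRingTV_energy_scale L hU.le]

/-- **UNIT FORM of the sector DQG value**: `OPT_DQG(L; t, U; a, b) = U · OPT_DQG(L; t/U, 1; a, b)`, `U > 0`. -/
theorem hubbardRingTV_pqgSectorEnergy_eq_mul_unit (L : ℕ) (t : ℚ) {U : ℚ} (hU : 0 < U) (a b : ℕ) :
    Model.pqgSectorEnergy (hubbardRingTV L t U) a b =
      (U : ℝ) * Model.pqgSectorEnergy (hubbardRingTV L (t / U) 1) a b := by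
  rw [hubbardRingTV_eq_unit_scaled L t hU.ne', hubbardRingTV_pqgSectorEnergy_scale L hU.le]

/-- **UNIT FORM of the singlet DQG value**: `OPT_DQG+S²(L; t, U; n) = U · OPT_DQG+S²(L; t/U, 1; n)`, `U > 0`. -/
theorem hubbardRingTV_pqgSingletEnergy_eq_mul_unit (L : ℕ) (t : ℚ) {U : ℚ} (hU : 0 < U) (n : ℕ) :
    Model.pqgSingletEnergy (hubbardRingTV L t U) n =
      (U : ℝ) * Model.pqgSingletEnergy (hubbardRingTV L (t / U) 1) n := by
  rw [hubbardRingTV_eq_unit_scaled L t hU.ne', hubbardRingTV_pqgSingletEnergy_scale L hU.le]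

/-! ## §4 The scaled gap of conjecture S-U is a function of `t/U` alone -/

/-- **`ĉ_DQG(L; t, U) = ĉ_DQG(L; t/U, 1)`**: for `U > 0`, `t ≠ 0` the sector scaled gap
`(U/4t²)·(E₀ − OPT_DQG)(L; t, U; a, b)` equals `(1/4x²)·(E₀ − OPT_DQG)(L; x, 1; a, b)` at `x = t/U` —
the dimensionless function `f` of STRUCTURE §2.2.7. -/
theorem hubbardRingTV_scaledGap_sector_eq_unit (L : ℕ) {t U : ℚ} (ht : t ≠ 0) (hU : 0 < U) (a b : ℕ) :
    ((U : ℝ) / (4 * (t : ℝ) ^ 2)) *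
        (Model.energy (hubbardRingTV L t U) a b - Model.pqgSectorEnergy (hubbardRingTV L t U) a b) =
      (1 / (4 * ((t / U : ℚ) : ℝ) ^ 2)) *
        (Model.energy (hubbardRingTV L (t / U) 1) a b - Model.pqgSectorEnergy (hubbardRingTV L (t / U) 1) a b) := by
  rw [hubbardRingTV_energy_eq_mul_unit L t hU, hubbardRingTV_pqgSectorEnergy_eq_mul_unit L t hU]
  have hU' : (U : ℝ) ≠ 0 := by exact_mod_cast hU.ne'
  have ht' : (t : ℝ) ≠ 0 := by exact_mod_cast ht
  push_cast
  field_simp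

/-- **`ĉ_DQG+S²(L; t, U) = ĉ_DQG+S²(L; t/U, 1)`** (`U > 0`, `t ≠ 0`; half filling `(n, n)`). -/
theorem hubbardRingTV_scaledGap_singlet_eq_unit (L : ℕ) {t U : ℚ} (ht : t ≠ 0) (hU : 0 < U) (n : ℕ) :
    ((U : ℝ) / (4 * (t : ℝ) ^ 2)) *
        (Model.energy (hubbardRingTV L t U) n n - Model.pqgSingletEnergy (hubbardRingTV L t U) n) =
      (1 / (4 * ((t / U : ℚ) : ℝ) ^ 2)) *
        (Model.energy (hubbardRingTV L (t / U) 1) n n - Model.pqgSingletEnergy (hubbardRingTV L (t / U) 1) n) := by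
  rw [hubbardRingTV_energy_eq_mul_unit L t hU, hubbardRingTV_pqgSingletEnergy_eq_mul_unit L t hU]
  have hU' : (U : ℝ) ≠ 0 := by exact_mod_cast hU.ne'
  have ht' : (t : ℝ) ≠ 0 := by exact_mod_cast ht
  push_cast
  field_simp

/-- **The S-U gap in the conjecture leaf's spelling (`t = 1`) is the scaled gap of the UNIT-REPULSION
ring at hopping `1/U`** (sector level): `(U/4)·(E₀ − OPT_DQG)(L; 1, U; a, b)
= (U²/4)·(E₀ − OPT_DQG)(L; 1/U, 1; a, b)`, `U > 0`. -/
theorem hubbardRingTV_conjectureGap_sector_eq_unit (L : ℕ) {U : ℚ} (hU : 0 < U) (a b : ℕ) :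
    ((U : ℝ) / 4) * (Model.energy (hubbardRingTV L 1 U) a b - Model.pqgSectorEnergy (hubbardRingTV L 1 U) a b) =
      ((U : ℝ) ^ 2 / 4) *
        (Model.energy (hubbardRingTV L (1 / U) 1) a b - Model.pqgSectorEnergy (hubbardRingTV L (1 / U) 1) a b) := by
  rw [hubbardRingTV_energy_eq_mul_unit L 1 hU, hubbardRingTV_pqgSectorEnergy_eq_mul_unit L 1 hU]
  ring

/-- **The S-U gap in the conjecture leaf's spelling (`t = 1`) is the scaled gap of the UNIT-REPULSION
ring at hopping `1/U`** (singlet level): `(U/4)·(E₀ − OPT_DQG+S²)(L; 1, U; n)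
= (U²/4)·(E₀ − OPT_DQG+S²)(L; 1/U, 1; n)`, `U > 0`. -/
theorem hubbardRingTV_conjectureGap_singlet_eq_unit (L : ℕ) {U : ℚ} (hU : 0 < U) (n : ℕ) :
    ((U : ℝ) / 4) * (Model.energy (hubbardRingTV L 1 U) n n - Model.pqgSingletEnergy (hubbardRingTV L 1 U) n) =
      ((U : ℝ) ^ 2 / 4) *
        (Model.energy (hubbardRingTV L (1 / U) 1) n n - Model.pqgSingletEnergy (hubbardRingTV L (1 / U) 1) n) := by
  rw [hubbardRingTV_energy_eq_mul_unit L 1 hU, hubbardRingTV_pqgSingletEnergy_eq_mul_unit L 1 hU]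
  ring

/-- **… and at hopping `−1/U` as well** (even `L`; sector level): the strong-coupling limit `U → ∞`
of S-U is the TWO-SIDED small-hopping limit `x → 0` of one unit-repulsion ring, in which the gap is
even (`Rows/HubbardRingTVHoppingSign.lean`). -/
theorem hubbardRingTV_conjectureGap_sector_eq_unit_neg {L : ℕ} (hL : Even L) {U : ℚ} (hU : 0 < U)
    (a b : ℕ) :
    ((U : ℝ) / 4) * (Model.energy (hubbardRingTV L 1 U) a b - Model.pqgSectorEnergy (hubbardRingTV L 1 U) a b) =
      ((U : ℝ) ^ 2 / 4) *
        (Model.energy (hubbardRingTV L (-(1 / U)) 1) a b -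
          Model.pqgSectorEnergy (hubbardRingTV L (-(1 / U)) 1) a b) := by
  rw [hubbardRingTV_conjectureGap_sector_eq_unit L hU, hubbardRingTV_gap_sector_neg_hopping hL]

/-- **… and at hopping `−1/U` as well** (even `L`; singlet level). -/
theorem hubbardRingTV_conjectureGap_singlet_eq_unit_neg {L : ℕ} (hL : Even L) {U : ℚ} (hU : 0 < U)
    (n : ℕ) :
    ((U : ℝ) / 4) * (Model.energy (hubbardRingTV L 1 U) n n - Model.pqgSingletEnergy (hubbardRingTV L 1 U) n) =
      ((U : ℝ) ^ 2 / 4) *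
        (Model.energy (hubbardRingTV L (-(1 / U)) 1) n n -
          Model.pqgSingletEnergy (hubbardRingTV L (-(1 / U)) 1) n) := by
  rw [hubbardRingTV_conjectureGap_singlet_eq_unit L hU, hubbardRingTV_gap_singlet_neg_hopping hL]

end Summit.Ventures.CertifiedQuantumChemistry

end
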